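import Mathlib
import HarnessLib
import Summits.HubbardSuperconductivity.HubbardSuperconductivity.Theorems.KLProgrammeKLRegimeEngineTowerWtStepLinkKlEng
import Summits.HubbardSuperconductivity.HubbardSuperconductivity.Theorems.KLProgrammeKLRegimeEnginePartitionFnUnits
import Summits.HubbardSuperconductivity.HubbardSuperconductivity.Theorems.KLProgrammeKLRegimeEngineE4ScaleDoor

/-!
# Route `KLProgramme` — crux K3 ENGINE (stmt-HubbardSuperconductivity-20437 `KLRegimeEngineV17F2`), stub (b) v2, THE WEIGHTED HALF «(b)-WT4»:
# W4 — «(ℓ)-Z-THREAD» ON THE WEIGHTED TRACK: `Z^K_{Λ_{dk}} ≠ 0 ⇒ Z^K_{Λ_{d(k+1)}} ≠ 0` FROM THE WEIGHTED LAW's OWN KIT GUARD — the `hZsucc` binder of W1/W3b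
# (cell gate-hubbard-kl, seat hubbard-kl-k3c3-p2 g17; weighted twin of this lineage's …TowerLevZUnitOfKitGuard (g16) on p5 g13's `isUnit_effPartitionFn_blockStep_wt`;
#  E1 may rename or supersede)

WHY (#18 «(Z)-EXPORT», the g16 located item «(ℓ)-Z-THREAD», verbatim on the weighted track).  The weighted block door (`klWtPinnedSumAt_klTowerIncr_le`, hence
g13's kit form and W2's LINK) reads `Δ_k = 𝒱_{d(k+1)} − 𝒱_{dk}` as ONE Gaussian step from `𝒱_{dk}` (`klTowerIncr_eq_effAction_sub`), which needs
`Z^K_{Λ_{dk}} ≠ 0`; at `k ≥ 2` that is derivable only from the induction's own state at block `k − 1`: `Z_{Λ_{d(k−1)}} ≠ 0` + the block door's smallness ⇒ the block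
step's partition function is a unit (p5 `isUnit_effPartitionFn_blockStep_wt`, same `κ`, weighted `α`, `ρ`, input sizes) ⇒ `Z_{Λ_{dk}} ≠ 0`
(`hubbardEffPartitionFnCT_klScale_ne_zero_of_step`).  The tokenised induction (…BookkeepingProfileTok, W1) carries `Zk k := Z^K_{Λ_{dk}} ≠ 0` with exactly one
propagation hypothesis `hZsucc : Zk k → (the law's kit guard at block k) → Zk (k+1)`; this file supplies it:
* §1 **`hubbardEffPartitionFnCT_klScale_block_succ_ne_zero_of_wtGuard`** — block `k ≥ 1`, `d ≥ 1`, ACTUAL block data (Gram `κ`, rate-`j` weighted rows/cols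
  `≤ α`, radius `ρ`), cap `D ≥ card/2`, and g13's absolute kit guard `e·α/κ²·towerV D ((e²(κ+ρ))²) (m′ ↦ ε·klTowerMeasWtAt … d k j (2m′)) < 1` (the SAME guard
  `klTowerBornWtAt_le_kit_units` is stated under) ⊢ `Z^K_{Λ_{d(k+1)}} ≠ 0`; the weighted input sizes are served by the carrier
  (`towerInputMajorant_of_klTowerMeasWtAt`, `towerInputSizes_eq`), the door's `θ < 1` by `normV_le_towerV`;
* §2 `wtLawGuard_eq_kitGuard` — at the k-free bounds of W2 (`κ′² ·8^{dk} = κ̄²`, `α′ = ᾱ·4^{dk}`, `c̄r`, `c̄c`) the law's literal guard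
  `Φ̄·towerV D τ̄ (W̄·Z̄^m·klTowerMeasWtAt … (2m)/klLevUnitF β M 0 m (dk−1)) ` EQUALS g13's absolute guard at `(κ′, α′, ρ := κ′)` (the identity used inside W2 §1, exported);
  **`hubbardEffPartitionFnCT_klScale_block_succ_ne_zero_of_wtLawGuard`** — the Z-step under W2's k-free bounds and the law's literal guard;
* §3 **`wtLaw_hZsucc_of_blockBounds`** — the `hZsucc` binder of W1 VERBATIM (`∀ k, 1 ≤ k → k < K_b → Zk k → guard → Zk (k+1)`, `Zk k := Z^K_{Λ_{dk}} ≠ 0`) from the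
  per-block data under the k-free bounds, names `W Z τ Φ` equational; **`wtLaw_hZsucc_klEng`** — the same ON THE FLOW FRAME with the block data DISCHARGED
  (W2b `linkDataW_klEng`), binders aligned with `wtLaw_hstep_klEng_tok`.
Compositions of landed theorems; nothing about the model is asserted beyond them; nothing asserts (b), (ℓ), any stub, K3 or superconductivity.
References: BGM 2006 §2.3 (2.13)–(2.14), §2.8 (2.76)–(2.84), §3 (3.2)–(3.8) [cite: BenfattoGiulianiMastropietro2006].
-/

noncomputable section

namespace Summit.HubbardSuperconductivity.HubbardSuperconductivity.Theorems.EngineV8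

set_option linter.dupNamespace false -- summit = problem name (single-conjunct summit), D-0017

open Classical
open Real Finset Literature.MathematicalPhysics.QuantumLattice Literature.Probability.LatticeModels GrassmannAlgebra
open Literature.MathematicalPhysics.QuantumLattice.FermiRG Literature.MathematicalPhysics.QuantumLattice.FermiRG.BGM2006Routing
open Literature.Probability.LatticeModels.BattleFederbush
open Summit.HubbardSuperconductivity.HubbardSuperconductivity.Theorems.KLProgrammeLegKernels
open Summit.HubbardSuperconductivity.HubbardSuperconductivity.Theorems.KLRegimeSplit
open Summit.HubbardSuperconductivity.HubbardSuperconductivity.Theorems.KLRegimeWick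
open Summit.HubbardSuperconductivity.HubbardSuperconductivity.Theorems.TwoPointAssembly
open Summit.HubbardSuperconductivity.HubbardSuperconductivity.Theorems.DispersionFlow
open Summit.HubbardSuperconductivity.HubbardSuperconductivity.Theorems.TorusFourierL2

variable {L M : ℕ} [NeZero L] [NeZero M]

/-! ## §1 The Z-step from the actual block data and g13's absolute kit guard -/

/-- **`Z^K_{Λ_{dk}} ≠ 0` ⇒ `Z^K_{Λ_{d(k+1)}} ≠ 0` UNDER THE WEIGHTED BLOCK DATA AND THE ABSOLUTE KIT GUARD** (block `k ≥ 1`, `d ≥ 1`): Gram constant `κ` of the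
fat-sandwiched slice, its rate-`j` weighted rows/cols `≤ α`, a radius `ρ > 0`, a cap `D ≥ card/2`, and the guard
`e·α/κ²·towerV D ((e²(κ+ρ))²) (m′ ↦ ε·klTowerMeasWtAt … d k j (2m′)) < 1`. [cite: BenfattoGiulianiMastropietro2006, §2.3 (2.13)-(2.14), §3 (3.2)-(3.8)] -/
theorem hubbardEffPartitionFnCT_klScale_block_succ_ne_zero_of_wtGuard {β : ℝ} (hβ : 0 < β) (U μ : ℝ) (K : TrigPolyC4v) {d k : ℕ} (j : ℕ)
    (hd : 1 ≤ d) (hk : 1 ≤ k) (hZ : hubbardEffPartitionFnCT L M β U μ 0 K (klScale klE0 (d * k)) ≠ 0)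
    {κ : ℝ} (hκ : 0 < κ)
    (hGB : IsGramBoundedR ((sectorSubMatrix L M β (bgmFatMultiplier L M klE0 β (nambuXiCT L μ K) (d * k - 1))).transpose *
      hubbardCovSliceCT L M β μ 0 K (klScale klE0 (d * (k + 1))) (klScale klE0 (d * k)) *
        sectorSubMatrix L M β (bgmFatMultiplier L M klE0 β (nambuXiCT L μ K) (d * k - 1))) κ)
    {α : ℝ} (hα : 0 < α)
    (hrow : ∀ X, ∑ Y, ‖((sectorSubMatrix L M β (bgmFatMultiplier L M klE0 β (nambuXiCT L μ K) (d * k - 1))).transpose *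
        hubbardCovSliceCT L M β μ 0 K (klScale klE0 (d * (k + 1))) (klScale klE0 (d * k)) *
          sectorSubMatrix L M β (bgmFatMultiplier L M klE0 β (nambuXiCT L μ K) (d * k - 1))) X Y‖ *
        klScaleWt L M β j {latticeLegPos (2 * (2 * M)) X, latticeLegPos (2 * (2 * M)) Y} ≤ α)
    (hcol : ∀ Y, ∑ X, ‖((sectorSubMatrix L M β (bgmFatMultiplier L M klE0 β (nambuXiCT L μ K) (d * k - 1))).transpose *
        hubbardCovSliceCT L M β μ 0 K (klScale klE0 (d * (k + 1))) (klScale klE0 (d * k)) *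
          sectorSubMatrix L M β (bgmFatMultiplier L M klE0 β (nambuXiCT L μ K) (d * k - 1))) X Y‖ *
        klScaleWt L M β j {latticeLegPos (2 * (2 * M)) X, latticeLegPos (2 * (2 * M)) Y} ≤ α)
    {ρ : ℝ} (hρ : 0 < ρ) {D : ℕ} (hD : Fintype.card (SpaceTimeIdx L M × SectorLeg (sectorCount (d * k - 1))) / 2 ≤ D)
    (hguard : Real.exp 1 * α / κ ^ 2 *
      towerV D ((Real.exp 2 * (κ + ρ)) ^ 2) (fun m' => imagTimeWeight β M * klTowerMeasWtAt L M β U μ K d k j (2 * m')) < 1) :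
    hubbardEffPartitionFnCT L M β U μ 0 K (klScale klE0 (d * (k + 1))) ≠ 0 := by
  have hε := imagTimeWeight_pos_of_pos (M := M) hβ
  have hJ₁ : 1 ≤ d * k := hk.trans (Nat.le_mul_of_pos_left k hd)
  have hJ : d * k ≤ d * (k + 1) := Nat.mul_le_mul_left d (Nat.le_succ k)
  -- the weighted input sizes served by the carrier
  set B : ℕ → ℝ := fun m' => klTowerMeasWtAt L M β U μ K d k j (2 * m') / imagTimeWeight β M ^ (2 * m' - 1) with hBdef
  have hB0 : ∀ m', 0 ≤ B m' := fun m' => div_nonneg (klTowerMeasWtAt_nonneg hβ.le U μ K d k j _) (pow_nonneg hε.le _)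
  have hB : ∀ (m' : ℕ) (t : Fin (2 * m')) (w : SpaceTimeIdx L M × SectorLeg (sectorCount (d * k - 1))),
      ∑ Y ∈ univ.filter (fun Y : Fin (2 * m') → SpaceTimeIdx L M × SectorLeg (sectorCount (d * k - 1)) => Y t = w),
        klScaleWt L M β j ((univ.image Y).image (latticeLegPos (2 * (2 * M)))) *
          ‖kernel ℂ (ExteriorAlgebra.map (Matrix.toLin' (sectorAnalysisMatrix L M β (klAnisoFamily L M β μ K klE0 (d * k - 1))))
            (klTowerInput L M β U μ K d k)) (2 * m') Y‖ ≤ B m' :=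
    fun m' t w => towerInputMajorant_of_klTowerMeasWtAt hβ U μ K d k j m' t w
  have hNeq := towerInputSizes_eq (L := L) (M := M) hβ U μ K d k j
  -- the door's `θ < 1` from the kit guard
  have hN0 : ∀ m', 0 ≤ (fun m' => imagTimeWeight β M ^ (2 * m') * B m') m' := fun m' => by have := hB0 m'; positivity
  have hN00 : (fun m' => imagTimeWeight β M ^ (2 * m') * B m') 0 = 0 := by simp [hBdef, klTowerMeasWtAt_zero]
  have hnV := normV_le_towerV (Γ := SpaceTimeIdx L M × SectorLeg (sectorCount (d * k - 1))) hκ.le hρ.le hN0 hN00 hD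
  have hθ : Real.exp 1 * α * normV (SpaceTimeIdx L M × SectorLeg (sectorCount (d * k - 1))) κ ρ
      (fun m' => imagTimeWeight β M ^ (2 * m') * B m') / κ ^ 2 < 1 := by
    have heq : Real.exp 1 * α * normV (SpaceTimeIdx L M × SectorLeg (sectorCount (d * k - 1))) κ ρ
        (fun m' => imagTimeWeight β M ^ (2 * m') * B m') / κ ^ 2 =
        Real.exp 1 * α / κ ^ 2 * normV (SpaceTimeIdx L M × SectorLeg (sectorCount (d * k - 1))) κ ρ
          (fun m' => imagTimeWeight β M ^ (2 * m') * B m') := by ring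
    rw [heq]
    refine lt_of_le_of_lt (mul_le_mul_of_nonneg_left hnV (by positivity)) ?_
    rw [hBdef, hNeq]
    exact hguard
  -- the step partition function is a unit (p5 g13, weighted track), hence the partition function at the next boundary
  have hunit := isUnit_effPartitionFn_blockStep_wt (L := L) (M := M) (isTreeWeight_klScaleWt L M hβ.le j) hβ μ K (J₁ := d * k) (J₂ := d * (k + 1))
    hJ₁ hJ (latticeLegPos (2 * (2 * M))) (klTowerInput L M β U μ K d k) (klEffectiveAction_mem_evenPart hβ.ne' U μ K klE0 (d * k))
    (constPart_klEffectiveAction_eq_zero β U μ K klE0 (d * k) hZ) hκ hGB B hB0 hB hα hrow hcol hρ hθ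
  exact hubbardEffPartitionFnCT_klScale_ne_zero_of_step β U μ K (d * (k + 1)) hZ hunit

/-! ## §2 The Z-step under W2's k-free bounds and the law's literal guard -/

/-- **The weighted law's literal guard EQUALS g13's absolute kit guard at the bounds** (the identity inside W2 §1, exported): for `κ′ > 0` with
`κ′²·8^{dk} = κ̄²`, `1 ≤ dk`, and `ᾱ, c̄r, c̄c > 0`,
`Φ̄·towerV D τ̄ (m ↦ W̄·Z̄^m·klTowerMeasWtAt … (2m)/klLevUnitF β M 0 m (dk−1)) = e·(ᾱ4^{dk})/κ′²·towerV D ((e²(κ′+κ′))²) (m′ ↦ ε·klTowerMeasWtAt … (2m′))`. -/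
theorem wtLawGuard_eq_kitGuard {β : ℝ} (hβ : 0 < β) (U μ : ℝ) (K : TrigPolyC4v) {d k : ℕ} (j : ℕ) (hdk : 1 ≤ d * k)
    {κ' κb αb crb ccb : ℝ} (hκ'0 : 0 < κ') (hκ'sq : κ' ^ 2 * (8 : ℝ) ^ (d * k) = κb ^ 2) (hαb : 0 < αb) (hcrb : 0 < crb) (hccb : 0 < ccb) (D : ℕ) :
    exp 1 * αb * ccb / (κb ^ 2 * crb) *
      towerV D (4 * exp 4 * κb ^ 2 / ccb ^ 2)
        (fun m => 32 * crb / ccb * (imagTimeWeight β M ^ 2 * ccb ^ 2 / 8) ^ m *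
          (klTowerMeasWtAt L M β U μ K d k j (2 * m) / klLevUnitF β M 0 m (d * k - 1))) =
      Real.exp 1 * (αb * (4 : ℝ) ^ (d * k)) / κ' ^ 2 *
        towerV D ((Real.exp 2 * (κ' + κ')) ^ 2) (fun m' => imagTimeWeight β M * klTowerMeasWtAt L M β U μ K d k j (2 * m')) := by
  have hx : 0 < imagTimeWeight β M := imagTimeWeight_pos_of_pos (M := M) hβ
  have he4' : exp 4 = exp 2 ^ 2 := by rw [← Real.exp_nat_mul]; norm_num
  set ε : ℝ := imagTimeWeight β M with hε
  set Kc : ℝ := ε * ((((2 : ℝ) ^ (5 * (d * k - 1))))⁻¹ * (ε ^ 2)⁻¹) with hKc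
  set u : ℝ := (8 : ℝ) ^ (d * k - 1) * ε ^ 2 with hu
  set μ₁ : ℕ → ℝ := fun m => klTowerMeasWtAt L M β U μ K d k j (2 * m) / klLevUnitF β M 0 m (d * k - 1) with hμ₁
  have hKc0 : 0 < Kc := by positivity
  have hu0 : 0 < u := by positivity
  have h8succ : (8 : ℝ) ^ (d * k) = (8 : ℝ) ^ (d * k - 1) * 8 := by rw [← pow_succ, Nat.sub_add_cancel hdk]
  have h4succ : (4 : ℝ) ^ (d * k) = (4 : ℝ) ^ (d * k - 1) * 4 := by rw [← pow_succ, Nat.sub_add_cancel hdk]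
  have h32 : (2 : ℝ) ^ (5 * (d * k - 1)) = (4 : ℝ) ^ (d * k - 1) * (8 : ℝ) ^ (d * k - 1) := by
    rw [← mul_pow, show (4 : ℝ) * 8 = 2 ^ 5 by norm_num, ← pow_mul]
  have h8p : (0 : ℝ) < (8 : ℝ) ^ (d * k - 1) := by positivity
  have h4p : (0 : ℝ) < (4 : ℝ) ^ (d * k - 1) := by positivity
  have hμeq : (fun m : ℕ => klTowerMeasWtAt L M β U μ K d k j (2 * m) / (Kc * u ^ m)) = μ₁ := by
    rw [hμ₁, hKc, hu, hε]; exact towerMeasWtAt_div_units_eq hβ U μ K d k j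
  have habs : (fun m : ℕ => imagTimeWeight β M * klTowerMeasWtAt L M β U μ K d k j (2 * m)) = fun m : ℕ => (ε * Kc) * (u ^ m * μ₁ m) := by
    rw [← hμeq]; exact towerInputSizes_units (ε := ε) hu0.ne' hKc0.ne' (fun m => klTowerMeasWtAt L M β U μ K d k j m)
  have hμbar : (fun m : ℕ => 32 * crb / ccb * (imagTimeWeight β M ^ 2 * ccb ^ 2 / 8) ^ m *
      (klTowerMeasWtAt L M β U μ K d k j (2 * m) / klLevUnitF β M 0 m (d * k - 1))) =
      fun m : ℕ => (32 * crb / ccb) * ((ε ^ 2 * ccb ^ 2 / 8) ^ m * μ₁ m) := by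
    funext m; simp only [hμ₁, hε]; ring
  have hτeq : 4 * exp 4 * κb ^ 2 / ccb ^ 2 * (ε ^ 2 * ccb ^ 2 / 8) = (exp 2 * (κ' + κ')) ^ 2 * u := by
    simp only [hu]; rw [← hκ'sq, h8succ, he4']; field_simp; ring
  have hΦeq : exp 1 * αb * ccb / (κb ^ 2 * crb) * (32 * crb / ccb) = exp 1 * (αb * (4 : ℝ) ^ (d * k)) / κ' ^ 2 * (ε * Kc) := by
    simp only [hKc]
    rw [← hκ'sq, h8succ, h4succ, h32]
    field_simp
    ring
  rw [habs, hμbar, towerV_units, towerV_units, hτeq]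
  calc exp 1 * αb * ccb / (κb ^ 2 * crb) * ((32 * crb / ccb) * towerV D ((exp 2 * (κ' + κ')) ^ 2 * u) μ₁)
      = (exp 1 * αb * ccb / (κb ^ 2 * crb) * (32 * crb / ccb)) * towerV D ((exp 2 * (κ' + κ')) ^ 2 * u) μ₁ := by ring
    _ = (Real.exp 1 * (αb * (4 : ℝ) ^ (d * k)) / κ' ^ 2 * (ε * Kc)) * towerV D ((exp 2 * (κ' + κ')) ^ 2 * u) μ₁ := by rw [hΦeq]
    _ = Real.exp 1 * (αb * (4 : ℝ) ^ (d * k)) / κ' ^ 2 * ((ε * Kc) * towerV D ((exp 2 * (κ' + κ')) ^ 2 * u) μ₁) := by ring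

/-- **`Z^K_{Λ_{dk}} ≠ 0` ⇒ `Z^K_{Λ_{d(k+1)}} ≠ 0` UNDER W2's k-FREE BOUNDS AND THE WEIGHTED LAW's LITERAL GUARD** (block `k ≥ 1`, `d ≥ 1`): the block's Gram constant
with `κ²·8^{dk} ≤ κ̄²`, rate-`j` weighted rows/cols `≤ α ≤ ᾱ·4^{dk}`, overlap bounds `c̄r, c̄c > 0` (only through the names `W̄ Z̄ τ̄ Φ̄`), cap `D ≥ card/2`, and
`Φ̄·towerV D τ̄ (m ↦ W̄·Z̄^m·klTowerMeasWtAt … (2m)/klLevUnitF β M 0 m (dk−1)) < 1`. [cite: BenfattoGiulianiMastropietro2006, §2.3 (2.13)-(2.14), §3 (3.2)-(3.8)] -/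
theorem hubbardEffPartitionFnCT_klScale_block_succ_ne_zero_of_wtLawGuard {β : ℝ} (hβ : 0 < β) (U μ : ℝ) (K : TrigPolyC4v) {d k : ℕ} (j : ℕ)
    (hd : 1 ≤ d) (hk : 1 ≤ k) (hZ : hubbardEffPartitionFnCT L M β U μ 0 K (klScale klE0 (d * k)) ≠ 0)
    {κ κb : ℝ} (hκ : 0 < κ) (hκb : 0 < κb) (hκκb : κ ^ 2 * (8 : ℝ) ^ (d * k) ≤ κb ^ 2)
    (hGB : IsGramBoundedR ((sectorSubMatrix L M β (bgmFatMultiplier L M klE0 β (nambuXiCT L μ K) (d * k - 1))).transpose *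
      hubbardCovSliceCT L M β μ 0 K (klScale klE0 (d * (k + 1))) (klScale klE0 (d * k)) *
        sectorSubMatrix L M β (bgmFatMultiplier L M klE0 β (nambuXiCT L μ K) (d * k - 1))) κ)
    {α αb : ℝ} (hαb : 0 < αb) (hααb : α ≤ αb * (4 : ℝ) ^ (d * k))
    (hrow : ∀ X, ∑ Y, ‖((sectorSubMatrix L M β (bgmFatMultiplier L M klE0 β (nambuXiCT L μ K) (d * k - 1))).transpose *
        hubbardCovSliceCT L M β μ 0 K (klScale klE0 (d * (k + 1))) (klScale klE0 (d * k)) *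
          sectorSubMatrix L M β (bgmFatMultiplier L M klE0 β (nambuXiCT L μ K) (d * k - 1))) X Y‖ *
        klScaleWt L M β j {latticeLegPos (2 * (2 * M)) X, latticeLegPos (2 * (2 * M)) Y} ≤ α)
    (hcol : ∀ Y, ∑ X, ‖((sectorSubMatrix L M β (bgmFatMultiplier L M klE0 β (nambuXiCT L μ K) (d * k - 1))).transpose *
        hubbardCovSliceCT L M β μ 0 K (klScale klE0 (d * (k + 1))) (klScale klE0 (d * k)) *
          sectorSubMatrix L M β (bgmFatMultiplier L M klE0 β (nambuXiCT L μ K) (d * k - 1))) X Y‖ *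
        klScaleWt L M β j {latticeLegPos (2 * (2 * M)) X, latticeLegPos (2 * (2 * M)) Y} ≤ α)
    {crb ccb : ℝ} (hcrb : 0 < crb) (hccb : 0 < ccb)
    {D : ℕ} (hD : Fintype.card (SpaceTimeIdx L M × SectorLeg (sectorCount (d * k - 1))) / 2 ≤ D)
    (hguard : exp 1 * αb * ccb / (κb ^ 2 * crb) *
      towerV D (4 * exp 4 * κb ^ 2 / ccb ^ 2)
        (fun m => 32 * crb / ccb * (imagTimeWeight β M ^ 2 * ccb ^ 2 / 8) ^ m *
          (klTowerMeasWtAt L M β U μ K d k j (2 * m) / klLevUnitF β M 0 m (d * k - 1))) < 1) :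
    hubbardEffPartitionFnCT L M β U μ 0 K (klScale klE0 (d * (k + 1))) ≠ 0 := by
  have hJ₁ : 1 ≤ d * k := hk.trans (Nat.le_mul_of_pos_left k hd)
  have h8 : (0 : ℝ) < (8 : ℝ) ^ (d * k) := by positivity
  obtain ⟨κ', hκ'0, hκκ', hκ'sq⟩ := exists_sqrt_scaled hκ hκb h8 hκκb
  have hGB' := TorusFourierL2.isGramBoundedR_of_le hGB hκ.le hκκ'
  have hα'0 : 0 < αb * (4 : ℝ) ^ (d * k) := by positivity
  refine hubbardEffPartitionFnCT_klScale_block_succ_ne_zero_of_wtGuard hβ U μ K j hd hk hZ hκ'0 hGB' hα'0 (fun X => (hrow X).trans hααb)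
    (fun Y => (hcol Y).trans hααb) hκ'0 hD ?_
  rw [← wtLawGuard_eq_kitGuard hβ U μ K j hJ₁ hκ'0 hκ'sq hαb hcrb hccb D]
  exact hguard

/-! ## §3 The `hZsucc` binder of W1, uniformly in the block; on the flow frame with the data discharged -/

/-- **THE WEIGHTED LAW's TOKEN PROPAGATION** — the `hZsucc` binder of `klTowerBornWtAt_le_law_of_inputs_base_tokX` (W1) VERBATIM for the token
`Zk k := Z^K_{Λ_{dk}} ≠ 0`, from the per-block Gram and weighted-decay data under the k-free bounds of W2; the names `W Z τ Φ` equational (as in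
`wtLaw_hstep_of_blockBounds`; `σ ψ` do not enter the guard). [cite: BenfattoGiulianiMastropietro2006, §2.3 (2.13)-(2.14), §3 (3.2)-(3.8)] -/
theorem wtLaw_hZsucc_of_blockBounds {β : ℝ} (hβ : 0 < β) (U μ : ℝ) (K : TrigPolyC4v) {d : ℕ} (hd : 1 ≤ d) (j Kb : ℕ)
    {κb αb crb ccb : ℝ} (hκb : 0 < κb) (hαb : 0 < αb) (hcrb : 0 < crb) (hccb : 0 < ccb)
    (κ α : ℕ → ℝ) (hκ : ∀ k, 1 ≤ k → k < Kb → 0 < κ k) (hκκb : ∀ k, 1 ≤ k → k < Kb → κ k ^ 2 * (8 : ℝ) ^ (d * k) ≤ κb ^ 2)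
    (hααb : ∀ k, 1 ≤ k → k < Kb → α k ≤ αb * (4 : ℝ) ^ (d * k))
    (hGB : ∀ k, 1 ≤ k → k < Kb → IsGramBoundedR ((sectorSubMatrix L M β (bgmFatMultiplier L M klE0 β (nambuXiCT L μ K) (d * k - 1))).transpose *
      hubbardCovSliceCT L M β μ 0 K (klScale klE0 (d * (k + 1))) (klScale klE0 (d * k)) *
        sectorSubMatrix L M β (bgmFatMultiplier L M klE0 β (nambuXiCT L μ K) (d * k - 1))) (κ k))
    (hrow : ∀ k, 1 ≤ k → k < Kb → ∀ X, ∑ Y, ‖((sectorSubMatrix L M β (bgmFatMultiplier L M klE0 β (nambuXiCT L μ K) (d * k - 1))).transpose *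
        hubbardCovSliceCT L M β μ 0 K (klScale klE0 (d * (k + 1))) (klScale klE0 (d * k)) *
          sectorSubMatrix L M β (bgmFatMultiplier L M klE0 β (nambuXiCT L μ K) (d * k - 1))) X Y‖ *
        klScaleWt L M β j {latticeLegPos (2 * (2 * M)) X, latticeLegPos (2 * (2 * M)) Y} ≤ α k)
    (hcol : ∀ k, 1 ≤ k → k < Kb → ∀ Y, ∑ X, ‖((sectorSubMatrix L M β (bgmFatMultiplier L M klE0 β (nambuXiCT L μ K) (d * k - 1))).transpose *
        hubbardCovSliceCT L M β μ 0 K (klScale klE0 (d * (k + 1))) (klScale klE0 (d * k)) *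
          sectorSubMatrix L M β (bgmFatMultiplier L M klE0 β (nambuXiCT L μ K) (d * k - 1))) X Y‖ *
        klScaleWt L M β j {latticeLegPos (2 * (2 * M)) X, latticeLegPos (2 * (2 * M)) Y} ≤ α k)
    {D : ℕ} (hD : ∀ k, 1 ≤ k → k < Kb → Fintype.card (SpaceTimeIdx L M × SectorLeg (sectorCount (d * k - 1))) / 2 ≤ D)
    (W Z τ Φ : ℝ) (hW : W = 32 * crb / ccb) (hZ : Z = imagTimeWeight β M ^ 2 * ccb ^ 2 / 8)
    (hτ : τ = 4 * exp 4 * κb ^ 2 / ccb ^ 2) (hΦ : Φ = exp 1 * αb * ccb / (κb ^ 2 * crb)) :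
    ∀ k, 1 ≤ k → k < Kb → hubbardEffPartitionFnCT L M β U μ 0 K (klScale klE0 (d * k)) ≠ 0 →
      Φ * towerV D τ (fun m => W * Z ^ m * (klTowerMeasWtAt L M β U μ K d k j (2 * m) / klLevUnitF β M 0 m (d * k - 1))) < 1 →
      hubbardEffPartitionFnCT L M β U μ 0 K (klScale klE0 (d * (k + 1))) ≠ 0 := by
  intro k hk1 hkK hZk hguard
  subst hW hZ hτ hΦ
  exact hubbardEffPartitionFnCT_klScale_block_succ_ne_zero_of_wtLawGuard hβ U μ K j hd hk1 hZk (hκ k hk1 hkK) hκb (hκκb k hk1 hkK) (hGB k hk1 hkK) hαb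
    (hααb k hk1 hkK) (hrow k hk1 hkK) (hcol k hk1 hkK) hcrb hccb (hD k hk1 hkK) hguard

/-- **THE WEIGHTED LAW's TOKEN PROPAGATION ON THE FLOW FRAME, BLOCK DATA DISCHARGED** — `∃ Cκ Cb CJ > 0` (the LINK's constants, W2b `linkDataW_klEng`): under the v1
doors, an admissible history at scale `n`, `2 ≤ d`, every block count `Kb` with `d·Kb ≤ n_β+1`, `d·Kb ≤ n + d`, every rate `j` with `d·Kb ≤ j + d`, a cap `D`, with
`κ̄ ᾱ c̄r c̄c` and `W Z τ Φ` pinned by equations as in `wtLaw_hstep_klEng_tok`: for every block `1 ≤ k < Kb`,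
`Z^{K_n}_{Λ_{dk}} ≠ 0 → (the law's guard at block k) → Z^{K_n}_{Λ_{d(k+1)}} ≠ 0`. [cite: BenfattoGiulianiMastropietro2006, §2.3 (2.13)-(2.14), §3 (3.2)-(3.8)] -/
theorem wtLaw_hZsucc_klEng (d : ℕ) (R : RenConsts) (c'' : ℝ) (hc'' : 0 < c'') :
    ∃ Cκ Cb CJ : ℝ, 0 < Cκ ∧ 0 < Cb ∧ 0 < CJ ∧
      ∀ (G : GeoConsts) (P : SplitConsts) (Q : EngConsts) (c : ℝ), P.WF → R.WF2 → 0 < c → c ≤ klEngC₃6 P R →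
      ∀ μ ∈ klWindowC, ∀ U : ℝ, 0 < U → U ≤ klEngU₀9 P R c → c'' * U ≤ 1 →
      ∀ β : ℝ, klBetaMin ≤ β → β ≤ Real.exp (c / U ^ 2) →
      ∀ (L M : ℕ) [NeZero L] [NeZero M], klEngL₃ β U ≤ L → klEngM₃ β U L ≤ M →
      ∀ n : ℕ, 1 ≤ n → n ≤ nScales β + 1 → IsKLRegime U c (-(n : ℤ)) →
        HistP klPredsV17F2 L M G P Q R β U μ 0 n → FrameOK R U (nScales β) μ (klFlowFrameU L M β U μ n) →
        (∀ m, 1 ≤ m → m < n → FlowPieceOscAt L M c'' β U μ m) →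
      2 ≤ d → ∀ Kb : ℕ, d * Kb ≤ nScales β + 1 → d * Kb ≤ n + d → ∀ j : ℕ, d * Kb ≤ j + d →
      ∀ D : ℕ, (∀ k, 1 ≤ k → k < Kb → Fintype.card (SpaceTimeIdx L M × SectorLeg (sectorCount (d * k - 1))) / 2 ≤ D) →
      ∀ (κb αb crb ccb : ℝ), κb = Real.sqrt (2 * Cκ * klE0) → αb = Cb * ((M : ℝ) / β) * (4 : ℝ) ^ d / klE0 →
        crb = 81 * CJ * M / β → ccb = 162 * CJ * M / β →
      ∀ (W Z τ Φ : ℝ), W = 32 * crb / ccb → Z = imagTimeWeight β M ^ 2 * ccb ^ 2 / 8 →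
        τ = 4 * exp 4 * κb ^ 2 / ccb ^ 2 → Φ = exp 1 * αb * ccb / (κb ^ 2 * crb) →
      ∀ k, 1 ≤ k → k < Kb → hubbardEffPartitionFnCT L M β U μ 0 (klFlowFrameU L M β U μ n) (klScale klE0 (d * k)) ≠ 0 →
        Φ * towerV D τ (fun m => W * Z ^ m *
          (klTowerMeasWtAt L M β U μ (klFlowFrameU L M β U μ n) d k j (2 * m) / klLevUnitF β M 0 m (d * k - 1))) < 1 →
        hubbardEffPartitionFnCT L M β U μ 0 (klFlowFrameU L M β U μ n) (klScale klE0 (d * (k + 1))) ≠ 0 := by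
  obtain ⟨Cκ, Cb, CJ, hCκ, hCb, hCJ, hlink⟩ := linkDataW_klEng d R c'' hc''
  refine ⟨Cκ, Cb, CJ, hCκ, hCb, hCJ, ?_⟩
  intro G P Q c hP hR2 hc hc6 μ hμ U hU hU9 hcU β hβmin hβc L M _ _ hL3 hM3 n hn1 hnN hreg hhist hfr hosc hd Kb hKbN hKbn j hKbj D hD
    κb αb crb ccb hκb hαb hcrb hccb W Z τ Φ hW hZ' hτ hΦ k hk1 hkK hZk hguard
  have he : (0 : ℝ) < klE0 := by norm_num [klE0]
  have hβ : 0 < β := KLRegimeSplit.pos_of_klBetaMin_le hβmin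
  have hM0 : (0 : ℝ) < M := Nat.cast_pos.2 (Nat.pos_of_ne_zero (NeZero.ne M))
  have hκb0 : 0 < κb := by rw [hκb]; exact Real.sqrt_pos.2 (by positivity)
  have hαb0 : 0 < αb := by rw [hαb]; positivity
  have hcrb0 : 0 < crb := by rw [hcrb]; positivity
  have hccb0 : 0 < ccb := by rw [hccb]; positivity
  have hdk : 2 ≤ d * k := le_trans hd (Nat.le_mul_of_pos_right d hk1)
  have hkN : d * (k + 1) ≤ nScales β + 1 := le_trans (Nat.mul_le_mul_left d (by omega)) hKbN
  have h1 : d * k + d ≤ d * Kb := by rw [← Nat.mul_succ]; exact Nat.mul_le_mul_left d (by omega)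
  have hkn : d * k ≤ n := by omega
  have hkj : d * k ≤ j := by omega
  obtain ⟨hκpos, hκsq, hGB, hrow, hcol, hαle, -, -⟩ := hlink G P Q c hP hR2 hc hc6 μ hμ U hU hU9 hcU β hβmin hβc L M hL3 hM3 n hn1 hnN hreg hhist hfr hosc
    k hk1 hdk hkN hkn j hkj
  subst hW hZ' hτ hΦ hκb hαb
  exact hubbardEffPartitionFnCT_klScale_block_succ_ne_zero_of_wtLawGuard hβ U μ _ j (by omega) hk1 hZk hκpos hκb0 hκsq hGB hαb0 hαle hrow hcol hcrb0 hccb0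
    (hD k hk1 hkK) hguard

end Summit.HubbardSuperconductivity.HubbardSuperconductivity.Theorems.EngineV8

end
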